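import Literature.AlgebraicGeometry.Motives.RatFnFlatDescent
import Literature.AlgebraicGeometry.Motives.RatFnAffine
import Literature.RingTheory.UniqueFactorizationDomain.UnitsAtPrimes
import HarnessLib

/-!
# Rational functions on `Spec R` and along open immersions

Bookkeeping for the divisor calculus of `Motives/CartierDivisor` (`RatFn.IsUnitAt`,
`RatFn.functionFieldMap`) on affine schemes `Spec R` presented by an honest ring `R` — so that
commutative algebra in `R` (e.g. in a polynomial ring `R = B[t₁, …, tₙ]`) can be fed in without
passing through `Γ(Spec R, ⊤) ≅ R` each time — and along open immersions:

* `algebraMap_functionField_Spec` — Mathlib's `R → K(Spec R)` is the germ at the generic point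
  of `(ΓSpecIso R)⁻¹ r`;
* `isUnitAt_Spec_iff`, `isUnitAt_Spec_iff_mem_unitsAt` — **a rational function on `Spec R` is a
  unit at `𝔭` iff it is a quotient `c/d` with `c, d ∉ 𝔭`**, i.e. iff it lies in the subgroup
  `R_𝔭^× ⊆ K(Spec R)` (`Literature.RingTheory.UniqueFactorizationDomain.unitsAt`; Görtz–Wedhorn I,
  (2.10.2): `𝒪_{Spec R, 𝔭} = R_𝔭`), through Mathlib's `Spec.stalkIso`;
* `functionFieldMap_SpecMap` — for `g : R → S` with `Spec g` dominant,
  `(Spec g)^♯ ∘ (R → K(Spec R)) = (S → K(Spec S)) ∘ g`;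
* `isDominant_fromSpec`, `functionFieldMap_fromSpec` — for an affine open `U ⊆ X` of an integral
  scheme, the chart `Spec Γ(X, U) → X` (Mathlib `IsAffineOpen.fromSpec`) is dominant and
  `fromSpec^♯` sends the rational function of a section `b ∈ Γ(X, U)` to `b ∈ K(Spec Γ(X, U))`;
* `functionFieldMap_congr` — `f^♯ = g^♯` for `f = g`;
* `functionFieldMap_bijective_of_isOpenImmersion`, `functionFieldEquiv` — **an open immersion of
  integral schemes identifies the function fields** (Görtz–Wedhorn I, Prop. 3.29 (1):
  `K(X) = 𝒪_{X,η} = K(U)` for every non-empty open `U`);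
* `isUnitAt_iff_of_flat` — units ascend and descend along flat dominant morphisms
  (`RatFn.IsRegularAt.of_functionFieldMap`, `Motives/RatFnFlatDescent`).

Everything is proved; no named facts. Mathlib searched (pin v4.32.0) and used: `Spec.stalkIso`,
`Spec.algebraMap_stalkIso_inv`, `Scheme.ΓSpecIso_inv_naturality`, `Scheme.Hom.germ_stalkMap`,
`TopCat.Presheaf.germ_stalkSpecializes`, `IsAffineOpen.fromSpec_app_self`,
`IsAffineOpen.range_fromSpec`, `IsLocalization.AtPrime.isUnit_to_map_iff` /
`isUnit_mk'_iff`, `TopCat.Presheaf.stalkCongr`, `Scheme.Hom.stalkMap` (an isomorphism for open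
immersions); the tree's `Motives/CartierDivisor` (`toFunctionField_germ`,
`functionFieldMap_toFunctionField`), `Motives/RatFnAffine`, `Motives/RatFnFlatDescent`.

## References

* U. Görtz, T. Wedhorn, *Algebraic Geometry I: Schemes*, 2nd ed., Springer Spektrum (2020),
  doi:10.1007/978-3-658-30733-2: (2.10.2) (`𝒪_{Spec A,𝔭} = A_𝔭`), Prop. 3.29 (1) (p. 102).
  [GortzWedhorn2020]
-/

universe u

open CategoryTheory AlgebraicGeometry TopologicalSpace Opposite
open Literature.RingTheory.UniqueFactorizationDomain

noncomputable section

namespace Literature.AlgebraicGeometry.Motives.RatFn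

/-! ### Rational functions on `Spec R` -/

section Spec

variable (R : CommRingCat.{u}) [IsDomain R]

/-- Mathlib's `R → K(Spec R)` (through `StructureSheaf.toStalk` at the generic point) is the germ
at the generic point of the section `(ΓSpecIso R)⁻¹ r ∈ Γ(Spec R, ⊤)`. [folklore] -/
theorem algebraMap_functionField_Spec (r : R) :
    algebraMap R (Spec R).functionField r =
      (Spec R).presheaf.germ ⊤ (genericPoint (Spec R)) trivial ((Scheme.ΓSpecIso R).inv r) := by
  change (StructureSheaf.toStalk R (genericPoint (Spec R))) r = _
  rfl

/-- **A rational function on `Spec R` is a unit at `𝔭` iff it is `c/d` with `c, d ∉ 𝔭`**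
(`𝒪_{Spec R,𝔭} = R_𝔭`, Görtz–Wedhorn I, (2.10.2); Mathlib `Spec.stalkIso`).
[cite: GortzWedhorn2020, (2.10.2)] -/
theorem isUnitAt_Spec_iff (p : PrimeSpectrum R) (s : (Spec R).functionField) :
    IsUnitAt (X := Spec R) p s ↔ ∃ c d : R, c ∉ p.asIdeal ∧ d ∉ p.asIdeal ∧
      s * algebraMap R (Spec R).functionField d = algebraMap R (Spec R).functionField c := by
  have key : ∀ c : R, toFunctionField (X := Spec R) p
      ((Spec.stalkIso R p).inv (algebraMap R (Localization.AtPrime p.asIdeal) c)) =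
      algebraMap R (Spec R).functionField c := by
    intro c
    have h1 := ConcreteCategory.congr_hom (Spec.algebraMap_stalkIso_inv p) c
    change (Spec.stalkIso R p).inv (algebraMap R _ c) =
      (Spec R).presheaf.germ ⊤ p trivial ((Scheme.ΓSpecIso R).inv c) at h1
    rw [h1, toFunctionField_germ, algebraMap_functionField_Spec]
  constructor
  · rintro ⟨u, hu⟩
    have hu' : IsUnit ((Spec.stalkIso R p).hom u) := u.isUnit.map _
    obtain ⟨⟨c, d⟩, e⟩ := IsLocalization.surj p.asIdeal.primeCompl ((Spec.stalkIso R p).hom u)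
    simp only at e
    have hc : c ∉ p.asIdeal := by
      intro hc
      have h1 : IsUnit (algebraMap R (Localization.AtPrime p.asIdeal) c) := by
        rw [← e]; exact hu'.mul (IsLocalization.map_units _ d)
      exact (IsLocalization.AtPrime.isUnit_to_map_iff (Localization.AtPrime p.asIdeal)
        p.asIdeal c).1 h1 hc
    refine ⟨c, d, hc, d.2, ?_⟩
    have e2 : (u : (Spec R).presheaf.stalk p) * (Spec.stalkIso R p).inv (algebraMap R _ d) =
        (Spec.stalkIso R p).inv (algebraMap R _ c) := by
      have := congrArg (fun t => (Spec.stalkIso R p).inv t) e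
      simp only [map_mul] at this
      rwa [Iso.hom_inv_id_apply] at this
    have := congrArg (toFunctionField (X := Spec R) p) e2
    rw [map_mul, hu, key, key] at this
    exact this
  · rintro ⟨c, d, hc, hd, e⟩
    have hcd : IsUnit (IsLocalization.mk' (Localization.AtPrime p.asIdeal) c
        (⟨d, hd⟩ : p.asIdeal.primeCompl)) :=
      (IsLocalization.AtPrime.isUnit_mk'_iff (Localization.AtPrime p.asIdeal) p.asIdeal c _).2 hc
    refine ⟨(hcd.map (Spec.stalkIso R p).inv.hom).unit, ?_⟩
    rw [IsUnit.unit_spec]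
    have hd0 : algebraMap R (Spec R).functionField d ≠ 0 := fun h0 =>
      hd ((map_eq_zero_iff _ (IsFractionRing.injective R _)).1 h0 ▸ p.asIdeal.zero_mem)
    apply mul_right_cancel₀ hd0
    rw [e, ← key c, ← key d]
    change toFunctionField (X := Spec R) p ((Spec.stalkIso R p).inv _) * _ = _
    rw [← map_mul, ← map_mul, IsLocalization.mk'_spec]

/-- The same, in terms of `unitsAt`: **`h ∈ K(Spec R)` is a unit at `𝔭` iff `h ∈ R_𝔭^×`**.
[cite: GortzWedhorn2020, (2.10.2)] -/
theorem isUnitAt_Spec_iff_mem_unitsAt (p : PrimeSpectrum R) (s : (Spec R).functionField) :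
    IsUnitAt (X := Spec R) p s ↔ s ∈ unitsAt (Spec R).functionField p.asIdeal :=
  isUnitAt_Spec_iff R p s

omit [IsDomain R] in
/-- Specialisation in `Spec R` is inclusion of primes (Mathlib `PrimeSpectrum.le_iff_specializes`,
restated for points of the scheme `Spec R`). [folklore] -/
theorem specializes_Spec_of_le {p q : PrimeSpectrum R} (h : p.asIdeal ≤ q.asIdeal) :
    (p : Spec R) ⤳ (q : Spec R) :=
  (PrimeSpectrum.le_iff_specializes p q).1 h

/-- **`(Spec g)^♯` on elements of `R`**: for a ring map `g : R → S` of domains with `Spec g`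
dominant, `(Spec g)^♯ (r) = g r` in `K(Spec S)`. [folklore] -/
theorem functionFieldMap_SpecMap {R S : CommRingCat.{u}} [IsDomain R] [IsDomain S] (g : R ⟶ S)
    [IsDominant (Spec.map g)] (r : R) :
    functionFieldMap (Spec.map g) (algebraMap R (Spec R).functionField r) =
      algebraMap S (Spec S).functionField (g r) := by
  let ξ := genericPoint (Spec S)
  have h : (Spec.map g) ξ ⤳ genericPoint (Spec R) := specializes_genericPoint (Spec.map g)
  rw [algebraMap_functionField_Spec, algebraMap_functionField_Spec]
  change (Spec.map g).stalkMap ξ ((Spec R).presheaf.stalkSpecializes h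
    ((Spec R).presheaf.germ ⊤ (genericPoint (Spec R)) trivial ((Scheme.ΓSpecIso R).inv r))) = _
  rw [TopCat.Presheaf.germ_stalkSpecializes_apply, Scheme.Hom.germ_stalkMap_apply]
  congr 1
  change _ = (g ≫ (Scheme.ΓSpecIso S).inv) r
  exact (ConcreteCategory.congr_hom (Scheme.ΓSpecIso_inv_naturality g) r).symm

/-- `Spec g` is dominant for an injective ring map `g` (Mathlib
`PrimeSpectrum.denseRange_comap_iff_ker_le_nilRadical`). [folklore] -/
theorem isDominant_SpecMap_of_injective {R S : CommRingCat.{u}} (g : R ⟶ S)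
    (hg : Function.Injective g) : IsDominant (Spec.map g) := by
  refine ⟨?_⟩
  change DenseRange (PrimeSpectrum.comap g.hom)
  rw [PrimeSpectrum.denseRange_comap_iff_ker_le_nilRadical]
  intro x hx
  rw [RingHom.mem_ker] at hx
  have : x = 0 := hg (by rw [hx, map_zero])
  rw [this]
  exact Ideal.zero_mem _

end Spec

/-! ### The affine chart `Spec Γ(X, U) → X` -/

section FromSpec

variable {X : Scheme.{u}} [IsIntegral X] {U : X.Opens} (hU : IsAffineOpen U) [Nonempty U]

/-- The chart `Spec Γ(X, U) → X` of a non-empty affine open of an integral scheme is dominant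
(an open immersion with non-empty, hence dense, image). [folklore] -/
theorem isDominant_fromSpec : IsDominant hU.fromSpec :=
  ⟨by
    rw [DenseRange, hU.range_fromSpec]
    exact U.2.dense (Set.nonempty_coe_sort.1 ‹Nonempty U›)⟩

attribute [local instance] isDominant_fromSpec

/-- **`fromSpec^♯` on sections**: the rational function of `b ∈ Γ(X, U)` pulls back along the
chart `Spec Γ(X, U) → X` to `b ∈ K(Spec Γ(X, U))` (Mathlib `IsAffineOpen.fromSpec_app_self`:
on `U` the chart induces `(ΓSpecIso)⁻¹` on sections). [folklore] -/
theorem functionFieldMap_fromSpec (b : Γ(X, U)) :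
    haveI := isDominant_fromSpec hU
    functionFieldMap hU.fromSpec (algebraMap Γ(X, U) X.functionField b) =
      algebraMap Γ(X, U) (Spec Γ(X, U)).functionField b := by
  let ξ := genericPoint (Spec Γ(X, U))
  have hfξ : hU.fromSpec ξ ∈ U := FieldNorm.fromSpec_mem hU ξ
  have e1 : algebraMap Γ(X, U) X.functionField b =
      toFunctionField (hU.fromSpec ξ) (X.presheaf.germ U (hU.fromSpec ξ) hfξ b) :=
    (toFunctionField_germ hfξ b).symm
  rw [e1, functionFieldMap_toFunctionField, Scheme.Hom.germ_stalkMap_apply,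
    IsAffineOpen.fromSpec_app_self, CommRingCat.comp_apply, TopCat.Presheaf.germ_res_apply,
    toFunctionField_germ, algebraMap_functionField_Spec]

end FromSpec

/-! ### Function fields along open immersions; flat transfer of units -/

section OpenImmersion

variable {X Y : Scheme.{u}} [IsIntegral X] [IsIntegral Y]

/-- `f^♯ = g^♯` for equal (dominant) morphisms — to rewrite along equations of morphisms under
the instance argument. [folklore] -/
theorem functionFieldMap_congr {f g : Y ⟶ X} (h : f = g) [IsDominant f] [IsDominant g] :
    functionFieldMap f = functionFieldMap g := by
  subst h; rfl

/-- **An open immersion of integral schemes identifies the function fields**: `f^♯ : K(X) → K(Y)`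
is bijective for a dominant open immersion `f : Y → X` (both are the local ring at the common
generic point; Görtz–Wedhorn I, Prop. 3.29 (1)). [cite: GortzWedhorn2020, Prop. 3.29 (1) (p. 102)] -/
theorem functionFieldMap_bijective_of_isOpenImmersion (f : Y ⟶ X) [IsOpenImmersion f]
    [IsDominant f] : Function.Bijective (functionFieldMap f) := by
  refine ⟨(functionFieldMap f).injective, fun t => ?_⟩
  -- `f^♯ = stalkSpecializes ≫ stalkMap`, both isomorphisms here
  have hgen : f (genericPoint Y) = genericPoint X := genericPoint_eq_of_isOpenImmersion f
  have hspec : f (genericPoint Y) ⤳ genericPoint X := specializes_genericPoint f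
  haveI : IsIso (f.stalkMap (genericPoint Y)) := inferInstance
  let e₁ : X.presheaf.stalk (genericPoint X) ≅ X.presheaf.stalk (f (genericPoint Y)) :=
    TopCat.Presheaf.stalkCongr X.presheaf (by rw [hgen]; exact Inseparable.refl _)
  have he₁ : e₁.hom = X.presheaf.stalkSpecializes hspec := rfl
  obtain ⟨s, hs⟩ : ∃ s, f.stalkMap (genericPoint Y) s = t :=
    ⟨inv (f.stalkMap (genericPoint Y)) t, by
      rw [← CommRingCat.comp_apply, IsIso.inv_hom_id]; rfl⟩
  refine ⟨e₁.inv s, ?_⟩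
  change f.stalkMap (genericPoint Y) (X.presheaf.stalkSpecializes hspec (e₁.inv s)) = t
  rw [← he₁, Iso.inv_hom_id_apply, hs]

/-- The field isomorphism `f^♯ : K(X) ≃ K(Y)` of a dominant open immersion. [folklore] -/
def functionFieldEquiv (f : Y ⟶ X) [IsOpenImmersion f] [IsDominant f] :
    X.functionField ≃+* Y.functionField :=
  RingEquiv.ofBijective (functionFieldMap f) (functionFieldMap_bijective_of_isOpenImmersion f)

/-- `functionFieldEquiv` is `functionFieldMap` on elements. [folklore] -/
@[simp] theorem functionFieldEquiv_apply (f : Y ⟶ X) [IsOpenImmersion f] [IsDominant f]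
    (t : X.functionField) : functionFieldEquiv f t = functionFieldMap f t := rfl

/-- **Units ascend and descend along flat dominant morphisms**: `h` is a unit at `f y` iff
`f^♯ h` is a unit at `y` (descent of regularity of `f^♯ h` and of `f^♯ h⁻¹`,
`RatFn.IsRegularAt.of_functionFieldMap`). [folklore] -/
theorem isUnitAt_iff_of_flat (f : Y ⟶ X) [IsDominant f] [Flat f] (y : Y) (h : X.functionField) :
    IsUnitAt (f y) h ↔ IsUnitAt y (functionFieldMap f h) := by
  refine ⟨fun hh => hh.functionFieldMap, fun hh => ?_⟩
  rw [isUnitAt_iff] at hh ⊢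
  obtain ⟨h0, hreg, hinv⟩ := hh
  refine ⟨fun e => h0 (by rw [e, map_zero]), IsRegularAt.of_functionFieldMap f hreg,
    IsRegularAt.of_functionFieldMap f ?_⟩
  rwa [map_inv₀]

end OpenImmersion

end Literature.AlgebraicGeometry.Motives.RatFn

end
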